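import Summits.ResolutionOfSingularities.ResolutionOfSingularities.Theorems.FrobeniusClosingPatchingRelPerfectMonomialPolyhedraGameMarked
import HarnessLib

/-!
# Crux `PatchingRelPerfect` (stmt-ResolutionOfSingularities-16161), chain w52 — TargetsF3 (m)
# «M2-strong», COMBINATORIAL HALF, Route K step K10: BLOCKS of moves — a disjoint family of
# permissible strata is played in any order under any fresh names

[OURS · L1 W5.2 · design memo v3 (`L/res-type-075/M2STRONG-COMBINATORIAL-HALF.md`); fact-free;
nothing here is a statement of the manuscript under review]

A centre of Kollár's functorial sequence read on the toric model may have several connected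
components; each is a stratum `E_J` (file K9 `components`), the components are pairwise NOT faces of
a common stratum (`J ∪ J' ∉ Str`), and the single blow-up of the centre corresponds to playing all of
them, one game move each.  This file is the game-side bookkeeping of such a BLOCK:

* `State.moves m s mv` — play the list of moves `mv = [(J₁,e₁), …, (J_r,e_r)]` (marking `m`);
  `BlockPlay m s 𝒥 mv` — `mv` enumerates the family `𝒥` with fresh, pairwise distinct names;
* **`winnableAll_of_block`** — if every `J ∈ 𝒥 ≠ ∅` is permissible, distinct members are not faces
  of a common stratum, and EVERY block play of `𝒥` ends in a `WinnableAll m` state, then the state is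
  `WinnableAll m` (permissibility of the remaining members survives each move);
* the shape of the state after a block play: `moves_B`, `mem_moves_A_iff` (exponent vectors gain
  `|α_{J_i}| - m` at `e_i` and are unchanged on old indices), **`mem_moves_Str_iff`** (the stratum
  complex after the block: old strata containing no `J_i`, and `T₀ ∪ {e_i}` for old `T₀ ⊉ J_i` with
  `T₀ ∪ J_i` a stratum — star subdivisions at pairwise non-adjacent faces commute), `WF.moves`.
-/

-- `Summit.<Summit>.<Sub>.Theorems` with `Sub = Summit` (single-conjunct summit, D-0017)
set_option linter.dupNamespace false

namespace Summit.ResolutionOfSingularities.ResolutionOfSingularities.Theorems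

namespace PolyhedraGame

open Finset

/-! ## Playing a list of moves -/

/-- [OURS · W5.2 M2-strong] Play the moves `(J₁,e₁), …, (J_r,e_r)` in order, marking `m`. -/
noncomputable def State.moves (m : ℕ) : State → List (Finset ℕ × ℕ) → State
  | s, [] => s
  | s, (J, e) :: mv => State.moves m (move s J e m) mv

/-- [OURS] Unfolding. -/
@[simp] theorem moves_nil (m : ℕ) (s : State) : s.moves m [] = s := rfl

/-- [OURS] Unfolding. -/
@[simp] theorem moves_cons (m : ℕ) (s : State) (J : Finset ℕ) (e : ℕ) (mv : List (Finset ℕ × ℕ)) :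
    s.moves m ((J, e) :: mv) = (move s J e m).moves m mv := rfl

/-- [OURS · W5.2 M2-strong] `mv` is a BLOCK PLAY of the family `𝒥` from `s`: it plays each member of
`𝒥` exactly once, each time under a name fresh for the current state. -/
def BlockPlay (m : ℕ) : State → Finset (Finset ℕ) → List (Finset ℕ × ℕ) → Prop
  | _, 𝒥, [] => 𝒥 = ∅
  | s, 𝒥, (J, e) :: mv => J ∈ 𝒥 ∧ e ∉ s.B ∧ BlockPlay m (move s J e m) (𝒥.erase J) mv

/-- [OURS] Unfolding. -/
@[simp] theorem blockPlay_nil (m : ℕ) (s : State) (𝒥 : Finset (Finset ℕ)) : BlockPlay m s 𝒥 [] ↔ 𝒥 = ∅ :=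
  Iff.rfl

/-- [OURS] Unfolding. -/
@[simp] theorem blockPlay_cons (m : ℕ) (s : State) (𝒥 : Finset (Finset ℕ)) (J : Finset ℕ) (e : ℕ)
    (mv : List (Finset ℕ × ℕ)) :
    BlockPlay m s 𝒥 ((J, e) :: mv) ↔ J ∈ 𝒥 ∧ e ∉ s.B ∧ BlockPlay m (move s J e m) (𝒥.erase J) mv :=
  Iff.rfl

/-- [OURS] Well-formedness survives a list of moves. -/
theorem WF.moves {m : ℕ} {s : State} (hs : s.WF) : ∀ (mv : List (Finset ℕ × ℕ)), (s.moves m mv).WF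
  | [] => hs
  | (J, e) :: mv => WF.moves (WF.move hs J e m) mv

/-! ## Permissibility of the other members survives a move -/

/-- [OURS] A DISJOINT FAMILY of permissible strata: every member permissible (marking `m`), distinct
members not faces of a common stratum. -/
structure DisjointFamily (m : ℕ) (s : State) (𝒥 : Finset (Finset ℕ)) : Prop where
  /-- members are permissible -/
  perm : ∀ J ∈ 𝒥, PermissibleM m s J
  /-- distinct members are not faces of a common stratum -/
  disj : ∀ J ∈ 𝒥, ∀ J' ∈ 𝒥, J ≠ J' → J ∪ J' ∉ s.Str

/-- [OURS] After playing one member, the others remain a disjoint family of permissible strata. -/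
theorem DisjointFamily.erase_move {m : ℕ} {s : State} (hs : s.WF) {𝒥 : Finset (Finset ℕ)}
    (h : DisjointFamily m s 𝒥) {J : Finset ℕ} (hJ : J ∈ 𝒥) {e : ℕ} (he : e ∉ s.B) :
    DisjointFamily m (move s J e m) (𝒥.erase J) := by
  constructor
  · intro J' hJ'
    obtain ⟨hne, hJ'𝒥⟩ := Finset.mem_erase.mp hJ'
    obtain ⟨hstr, hne', hw⟩ := h.perm J' hJ'𝒥
    have hJJ' : ¬ J ⊆ J' := fun hsub => h.disj J hJ J' hJ'𝒥 (Ne.symm hne) (by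
      rwa [Finset.union_eq_right.mpr hsub])
    refine ⟨mem_moveStrata_iff.mpr (Or.inl ⟨hstr, hJJ'⟩), hne', fun β hβ => ?_⟩
    obtain ⟨α, hα, rfl⟩ := Finset.mem_image.mp hβ
    have heJ' : e ∉ J' := fun h' => he (hs.str_subset J' hstr h')
    have : weight J' (moveExp J e m α) = weight J' α :=
      Finset.sum_congr rfl fun j hj => moveExp_apply_of_ne α (fun h' => heJ' (h' ▸ hj))
    rw [this]
    exact hw α hα
  · intro J₁ hJ₁ J₂ hJ₂ hne hmem
    obtain ⟨-, hJ₁𝒥⟩ := Finset.mem_erase.mp hJ₁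
    obtain ⟨-, hJ₂𝒥⟩ := Finset.mem_erase.mp hJ₂
    have heU : e ∉ J₁ ∪ J₂ := by
      intro h'
      rcases Finset.mem_union.mp h' with h' | h'
      · exact he (hs.str_subset J₁ (h.perm J₁ hJ₁𝒥).1 h')
      · exact he (hs.str_subset J₂ (h.perm J₂ hJ₂𝒥).1 h')
    rcases mem_moveStrata_iff.mp hmem with ⟨hold, -⟩ | ⟨T₀, -, -, -, hT₀⟩
    · exact h.disj J₁ hJ₁𝒥 J₂ hJ₂𝒥 hne hold
    · exact heU (hT₀ ▸ Finset.mem_insert_self e T₀)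

/-- [OURS · W5.2 M2-strong · Route K] **A disjoint family of permissible strata can be played as a
block**: if every block play of `𝒥 ≠ ∅` ends in a `WinnableAll m` state, the state is `WinnableAll m`. -/
theorem winnableAll_of_block {m : ℕ} : ∀ (n : ℕ) {s : State} {𝒥 : Finset (Finset ℕ)}, 𝒥.card = n →
    s.WF → 𝒥.Nonempty → DisjointFamily m s 𝒥 →
    (∀ mv, BlockPlay m s 𝒥 mv → WinnableAll m (s.moves m mv)) → WinnableAll m s := by
  intro n
  induction n with
  | zero =>
    intro s 𝒥 hcard _ hne _ _
    exact absurd (Finset.card_eq_zero.mp hcard) hne.ne_empty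
  | succ n ih =>
    intro s 𝒥 hcard hs hne hfam hcont
    obtain ⟨J, hJ⟩ := hne
    refine WinnableAll.step J (hfam.perm J hJ) fun e he => ?_
    by_cases hlast : 𝒥.erase J = ∅
    · have := hcont [(J, e)] (by simp [hJ, he, hlast])
      simpa using this
    · refine ih (by rw [Finset.card_erase_of_mem hJ, hcard]; rfl) (WF.move hs J e m)
        (Finset.nonempty_iff_ne_empty.mpr hlast) (hfam.erase_move hs hJ he) fun mv hmv => ?_
      have := hcont ((J, e) :: mv) ((blockPlay_cons m s 𝒥 J e mv).mpr ⟨hJ, he, hmv⟩)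
      simpa using this

/-! ## The state after a block play -/

/-- [OURS] The live indices after a list of moves. -/
theorem moves_B (m : ℕ) : ∀ (s : State) (mv : List (Finset ℕ × ℕ)),
    (s.moves m mv).B = s.B ∪ (mv.map Prod.snd).toFinset
  | s, [] => by simp
  | s, (J, e) :: mv => by
    rw [moves_cons, moves_B m _ mv, move_B]
    ext b
    simp

/-- [OURS] In a block play the names are fresh and pairwise distinct, and the members are strata. -/
theorem BlockPlay.fresh {m : ℕ} : ∀ {s : State} {𝒥 : Finset (Finset ℕ)} {mv : List (Finset ℕ × ℕ)},
    BlockPlay m s 𝒥 mv → (∀ p ∈ mv, p.1 ∈ 𝒥 ∧ p.2 ∉ s.B) ∧ (mv.map Prod.snd).Nodup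
  | s, 𝒥, [], _ => by simp
  | s, 𝒥, (J, e) :: mv, h => by
    obtain ⟨hJ, he, hrest⟩ := (blockPlay_cons m s 𝒥 J e mv).mp h
    obtain ⟨h1, h2⟩ := BlockPlay.fresh hrest
    refine ⟨?_, ?_⟩
    · intro p hp
      rcases List.mem_cons.mp hp with rfl | hp
      · exact ⟨hJ, he⟩
      · obtain ⟨hp1, hp2⟩ := h1 p hp
        exact ⟨Finset.mem_of_mem_erase hp1, fun h' => hp2 (Finset.mem_insert_of_mem h')⟩
    · rw [List.map_cons, List.nodup_cons]
      refine ⟨fun hmem => ?_, h2⟩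
      obtain ⟨p, hp, hpe⟩ := List.mem_map.mp hmem
      exact (h1 p hp).2 (hpe ▸ Finset.mem_insert_self e s.B)

/-- [OURS] The exponent vector after a block (the iterated controlled transform). -/
noncomputable def blockExp (m : ℕ) : List (Finset ℕ × ℕ) → (ℕ →₀ ℕ) → (ℕ →₀ ℕ)
  | [], α => α
  | (J, e) :: mv, α => blockExp m mv (moveExp J e m α)

/-- [OURS] The exponent vectors after a list of moves. -/
theorem moves_A (m : ℕ) : ∀ (s : State) (mv : List (Finset ℕ × ℕ)),
    (s.moves m mv).A = s.A.image (blockExp m mv)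
  | s, [] => by simp [blockExp]
  | s, (J, e) :: mv => by
    rw [moves_cons, moves_A m _ mv]
    change (s.A.image (moveExp J e m)).image (blockExp m mv) = _
    rw [Finset.image_image]
    rfl

/-- [OURS] On an index which is not a name of the block, the exponent is unchanged. -/
theorem blockExp_apply_of_forall_ne (m : ℕ) : ∀ (mv : List (Finset ℕ × ℕ)) (α : ℕ →₀ ℕ) {b : ℕ},
    (∀ p ∈ mv, p.2 ≠ b) → blockExp m mv α b = α b
  | [], α, b, _ => rfl
  | (J, e) :: mv, α, b, hb => by
    rw [blockExp, blockExp_apply_of_forall_ne m mv _ fun p hp => hb p (List.mem_cons_of_mem _ hp),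
      moveExp_apply_of_ne α (hb (J, e) List.mem_cons_self).symm]

/-- [OURS] The exponent at a name of the block is `|α_J| - m` (names pairwise distinct, not members of
any centre of the block, and not in the support of `α`). -/
theorem blockExp_apply_name (m : ℕ) : ∀ (mv : List (Finset ℕ × ℕ)) (α : ℕ →₀ ℕ),
    (mv.map Prod.snd).Nodup → (∀ p ∈ mv, ∀ q ∈ mv, p.2 ∉ q.1) → (∀ p ∈ mv, α p.2 = 0) →
    ∀ p ∈ mv, blockExp m mv α p.2 = weight p.1 α - m
  | [], α, _, _, _, p, hp => absurd hp List.not_mem_nil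
  | (J, e) :: mv, α, hnd, hdisj, hα, p, hp => by
    rw [List.map_cons, List.nodup_cons] at hnd
    rw [blockExp]
    rcases List.mem_cons.mp hp with rfl | hp
    · -- the first move: later moves do not touch `e`
      rw [blockExp_apply_of_forall_ne m mv _ fun q hq h => hnd.1 (List.mem_map.mpr ⟨q, hq, h⟩)]
      simp [moveExp, hα (J, e) List.mem_cons_self]
    · have hw : weight p.1 (moveExp J e m α) = weight p.1 α :=
        Finset.sum_congr rfl fun j hj => moveExp_apply_of_ne α fun h =>
          hdisj (J, e) List.mem_cons_self p (List.mem_cons_of_mem _ hp) (h ▸ hj)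
      rw [blockExp_apply_name m mv (moveExp J e m α) hnd.2
          (fun p hp q hq => hdisj p (List.mem_cons_of_mem _ hp) q (List.mem_cons_of_mem _ hq))
          (fun q hq => ?_) p hp, hw]
      rw [moveExp_apply_of_ne α fun h => hnd.1 (List.mem_map.mpr ⟨q, hq, h⟩)]
      exact hα q (List.mem_cons_of_mem _ hq)

/-- [OURS · W5.2 M2-strong · Route K] **The stratum complex after a block play** of a disjoint family:
the old strata containing no centre of the block, and `T₀ ∪ {e}` for an old stratum `T₀ ⊉ J` with
`T₀ ∪ J` a stratum, `(J, e)` in the block (star subdivisions at pairwise non-adjacent faces commute). -/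
theorem mem_moves_Str_iff {m : ℕ} : ∀ (mv : List (Finset ℕ × ℕ)) {s : State} {𝒥 : Finset (Finset ℕ)},
    s.WF → DisjointFamily m s 𝒥 → BlockPlay m s 𝒥 mv → ∀ T' : Finset ℕ,
    T' ∈ (s.moves m mv).Str ↔
      (T' ∈ s.Str ∧ ∀ p ∈ mv, ¬ p.1 ⊆ T') ∨
        ∃ p ∈ mv, ∃ T₀ ∈ s.Str, ¬ p.1 ⊆ T₀ ∧ T₀ ∪ p.1 ∈ s.Str ∧ T' = insert p.2 T₀
  | [], s, 𝒥, _, _, _, T' => by simp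
  | (J, e) :: mv, s, 𝒥, hs, hfam, hplay, T' => by
    obtain ⟨hJ, he, hrest⟩ := (blockPlay_cons m s 𝒥 J e mv).mp hplay
    have ih := mem_moves_Str_iff mv (WF.move hs J e m) (hfam.erase_move hs hJ he) hrest T'
    rw [moves_cons, ih]
    -- facts about the later moves
    have hfresh := BlockPlay.fresh hrest
    have hJstr : J ∈ s.Str := (hfam.perm J hJ).1
    have hlater : ∀ p ∈ mv, p.1 ∈ s.Str ∧ p.1 ≠ J ∧ J ∪ p.1 ∉ s.Str ∧ e ∉ p.1 ∧ p.2 ≠ e := by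
      intro p hp
      obtain ⟨hp1, hp2⟩ := hfresh.1 p hp
      obtain ⟨hne, hp1'⟩ := Finset.mem_erase.mp hp1
      refine ⟨(hfam.perm _ hp1').1, hne, hfam.disj J hJ _ hp1' (Ne.symm hne), fun h => he
        (hs.str_subset _ (hfam.perm _ hp1').1 h), fun h => hp2 (h ▸ Finset.mem_insert_self e s.B)⟩
    have heStr : ∀ T ∈ s.Str, e ∉ T := fun T hT h => he (hs.str_subset T hT h)
    constructor
    · rintro (⟨hT', hmv⟩ | ⟨p, hp, T₀, hT₀, hpT₀, hT₀p, rfl⟩)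
      · -- `T'` is a stratum of `move s J e` avoiding all later centres
        rcases mem_moveStrata_iff.mp hT' with ⟨hold, hJT⟩ | ⟨T₀, hT₀, hJT₀, hT₀J, rfl⟩
        · exact Or.inl ⟨hold, fun p hp => by
            rcases List.mem_cons.mp hp with rfl | hp
            · exact hJT
            · exact hmv p hp⟩
        · exact Or.inr ⟨(J, e), List.mem_cons_self, T₀, hT₀, hJT₀, hT₀J, rfl⟩
      · -- `T' = insert p.2 T₀` with `T₀` a stratum of `move s J e`
        obtain ⟨hp1, hpJ, hJp, hep, hpe⟩ := hlater p hp
        rcases mem_moveStrata_iff.mp hT₀ with ⟨hold, hJT⟩ | ⟨T₁, hT₁, hJT₁, hT₁J, rfl⟩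
        · rcases mem_moveStrata_iff.mp hT₀p with ⟨hold', -⟩ | ⟨T₁, -, -, -, hT₁⟩
          · exact Or.inr ⟨p, List.mem_cons_of_mem _ hp, T₀, hold, hpT₀, hold', rfl⟩
          · exfalso
            have : e ∈ T₀ ∪ p.1 := hT₁ ▸ Finset.mem_insert_self e T₁
            rcases Finset.mem_union.mp this with h | h
            · exact heStr T₀ hold h
            · exact hep h
        · -- `T₀ = insert e T₁`: then `(insert e T₁) ∪ p.1` would be a new stratum over `T₁ ∪ p.1 ∪ J`
          exfalso
          rcases mem_moveStrata_iff.mp hT₀p with ⟨hold', -⟩ | ⟨T₂, hT₂, -, hT₂J, hT₂eq⟩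
          · exact heStr _ hold' (Finset.mem_union_left _ (Finset.mem_insert_self e T₁))
          · have hT₂' : T₂ = T₁ ∪ p.1 := by
              have h1 : e ∉ T₂ := heStr T₂ hT₂
              have h2 : insert e T₂ = insert e (T₁ ∪ p.1) := by rw [hT₂eq, Finset.insert_union]
              rw [← Finset.erase_insert h1, h2, Finset.erase_insert]
              intro h; rcases Finset.mem_union.mp h with h | h
              · exact heStr T₁ hT₁ h
              · exact hep h
            apply hJp
            refine hs.str_down _ (hT₂' ▸ hT₂J) _ ?_
            intro x hx
            rcases Finset.mem_union.mp hx with hx | hx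
            · exact Finset.mem_union_right _ hx
            · exact Finset.mem_union_left _ (Finset.mem_union_right _ hx)
    · rintro (⟨hT', hmv⟩ | ⟨p, hp, T₀, hT₀, hpT₀, hT₀p, rfl⟩)
      · refine Or.inl ⟨mem_moveStrata_iff.mpr (Or.inl ⟨hT', hmv (J, e) List.mem_cons_self⟩),
          fun p hp => hmv p (List.mem_cons_of_mem _ hp)⟩
      · rcases List.mem_cons.mp hp with rfl | hp
        · -- the first move's new stratum: later centres avoid it
          refine Or.inl ⟨mem_moveStrata_iff.mpr (Or.inr ⟨T₀, hT₀, hpT₀, hT₀p, rfl⟩), fun q hq hq' => ?_⟩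
          obtain ⟨-, -, hJq, heq, -⟩ := hlater q hq
          have hqT₀ : q.1 ⊆ T₀ := fun x hx => by
            rcases Finset.mem_insert.mp (hq' hx) with rfl | h
            · exact absurd hx heq
            · exact h
          exact hJq (hs.str_down _ hT₀p _
            (Finset.union_subset Finset.subset_union_right (hqT₀.trans Finset.subset_union_left)))
        · -- a later move's new stratum, over an old `T₀`
          obtain ⟨-, -, hJp, -, -⟩ := hlater p hp
          have hJT₀ : ¬ J ⊆ T₀ := fun h => hJp (hs.str_down _ hT₀p _
            (Finset.union_subset (h.trans Finset.subset_union_left) Finset.subset_union_right))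
          have hJT₀p : ¬ J ⊆ T₀ ∪ p.1 := fun h => hJp (hs.str_down _ hT₀p _
            (Finset.union_subset h Finset.subset_union_right))
          exact Or.inr ⟨p, hp, T₀, mem_moveStrata_iff.mpr (Or.inl ⟨hT₀, hJT₀⟩), hpT₀,
            mem_moveStrata_iff.mpr (Or.inl ⟨hT₀p, hJT₀p⟩), rfl⟩

end PolyhedraGame

end Summit.ResolutionOfSingularities.ResolutionOfSingularities.Theorems
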